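import Summits.QuantumFields.YangMills.Theorems.FluctuationComparisonRegPrIntLS2BetaSU2FourFactorExpansion
import HarnessLib

/-!
# S2β · (L♭) road, way-out (a) «kinematic» — THE PLAQUETTE WORD OF FOUR EXPONENTIALS TO THIRD ORDER IN `ℍ`:
# `e^a e^b (e^c)⁻¹ (e^d)⁻¹ = 1 + ιℓ + ½(ιℓ)² + ½K + O(τ³)`, `ℓ = a + b − c − d`, `K = Σ_{i<j} [ιa_i, ιa_j]`, and the VARIATION FORM
# `K = 2[ιa, ιd] + O(τ·(‖c − a‖ + ‖b − d‖))` — the quadratic term of a plaquette is the commutator of its two DIRECTIONS at the base corner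

Cell `ym3-torus` (rung R3 = continuum `SU(2)` Yang–Mills on the three-torus — NOT d = 4, NOT infinite volume, NOT a mass gap, NOT Clay).
Width seat «width 21» `ym3-torus-px21` (gen 23), FREE px helper on crux `stmt-QuantumFields-20520` (`Theses.UnitScaleTilt.FluctuationComparisonRegPrIntL`);
`--kind proof --supports stmt-QuantumFields-20520 --as helper`, count-neutral, DEFINITION-FREE (0 `def`, 0 `instance`, 0 `notation`, 0 `sorry`, default heartbeats).
GO px16 g22 14:45:27Z («GO px21 on (a)-kinematic»), px12 g24 14:44:38Z («GO — not MINE»).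

WHY (UV3-NODE §84∕§86.5; px12 g24 14:42:08Z RISK, px8 g24 ✓`…S2BetaSmallBondGaugeToronObstruction`).  The (L♭) sup-profile bootstrap of the two stage towers
(✓`…S2BetaContractingSupStart.sup_bootstrap_start`, step ✓`…S2BetaRelativeTowerSupProfile.arc_le_sup_step_hatLift`) has the quadratic coefficient
`C₂ = (π∕2)·N_P·24·L⁻²` coming from the FIRST-order four-factor letter ✓`…SU2FourFactorExpansion.dist1_plaq4_le` (`dist1 ≤ ‖ℓ‖ + 12τ²`) applied to the fine
plaquettes of the hat lift; the resulting start threshold `M(L) ≈ (1 − L⁻¹)∕(2C₂) ≈ 10⁻²` is below the toron floor of small volumes.  Way-out (a) needs the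
plaquette word to SECOND order with the quadratic term identified, so that it can be MATCHED against the coarse plaquettes (companion file, the refined (F3)
letter) instead of being thrown into `12τ²`.  This file is the pure-algebra core:
* §1 `imQuat_mul_self` (`(ιx)² = −‖x‖²`), `norm_imQuat_mul_self`, ★`norm_two_mul_exp_imQuat_sub_le` (`‖2(e^{ιx} − 1 − ιx) − (ιx)²‖ ≤ ‖x‖³∕2`, `‖x‖ ≤ 1`;
  `cos` to fourth order `Real.cos_bound`, `sin` to third order `Real.sin_gt_sub_cube`).
* §2 ★`norm_mul_second_order` (ANY normed ring: the two-factor telescoping to second order, doubled to avoid halves —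
  `2(xy − 1) − 2(a + b) − (q_a + q_b + 2ab) = (2(x−1) − 2a − q_a) + (2(y−1) − 2b − q_b) + 2((x−1−a)(y−1) + a(y−1−b))`).
* §3 ★`norm_fourFactor_second_order` (any normed ring: the three-step bookkeeping, `34.5τ³ ≤ 35τ³`), ★★`norm_su2Quat_plaq4_second_le` — THE LETTER: for `‖a‖, ‖b‖, ‖c‖, ‖d‖ ≤ τ ≤ 1∕4`,
  `‖2(q − 1 − ιℓ) − (ιℓ)² − K‖ ≤ 35τ³`, `q = su2Quat (e^a e^b (e^c)⁻¹ (e^d)⁻¹)`, `K = [ιa,ιb] − [ιa,ιc] − [ιa,ιd] − [ιb,ιc] − [ιb,ιd] + [ιc,ιd]` (written out).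
* §4 `norm_comm_sub_comm_le_add` (commutator Lipschitz, both arguments free), ★`norm_commSum_sub_two_comm_le` (the variation form:
  `‖K − 2[A,D]‖ ≤ 6τ(‖C − A‖ + ‖B − D‖) + 2‖C − A‖‖B − D‖` in any normed ring), and the user-facing pair
  ★★`dist1_plaq4_le_comm` ∕ ★★`norm_lincurl_add_comm_le_dist1_add`:
      `dist1 (e^a e^b (e^c)⁻¹ (e^d)⁻¹) ⋚ ‖ι(a+b−c−d) + [ιa, ιd]‖ ± (½‖a+b−c−d‖² + 3τ(‖c−a‖ + ‖b−d‖) + ‖c−a‖‖b−d‖ + (35∕2)τ³)`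
  (for the lattice plaquette `U(x,μ)U(x+μ,ν)U(x+ν,μ)⁻¹U(x,ν)⁻¹`: `c − a`, `b − d` are the two PARALLEL variations across the plaquette and `[ιa, ιd]` the commutator of
  the two bonds at the base corner — a SMALL plaquette forces `ιℓ ≈ −[ιa, ιd]`, which is what the hat lift's fine commutator is matched against), and the `SU(2)`-element
  edition ★★`norm_lincurl_logVec_add_comm_le` (arcs `≤ τ`).

HONEST SCOPE.  Elementary algebra in `ℍ` and trigonometric Taylor bounds; every constant explicit and crude (`35 = ⌈34.5⌉`); nothing of Bałaban's analysis is asserted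
or proved ([Balaban1985Variational] (34) p.283 is the printed second-order plaquette expansion this refines by one order; [Balaban1985RegularSpaces] (1.29) p.81 is where the
size-and-derivative bounds of small fields live); the refined (F3) letter, the `(s, v)` profile recursion, (L♭), S2β, crux 20520 and `YM3TorusSU2` are NOT proved; no registered
stub is closed; rung R3 = SU(2) YM₃ on T³ — NOT d = 4, NOT infinite volume, NOT a mass gap, NOT Clay; the Yang–Mills mass gap is NOT proved.
References: T. Bałaban, CMP **102** (1985) 277–309 [Balaban1985Variational]; CMP **99** (1985) 75–102 [Balaban1985RegularSpaces]; CMP **109** (1987) 249–301 [Balaban1987RG1].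
-/

set_option autoImplicit false

namespace Summit.QuantumFields.YangMills.Theorems.FluctuationComparisonRegPrIntLS2BetaSU2FourFactorSecondOrder

open scoped Real Quaternion
open NormedSpace
open Literature.MathematicalPhysics.QuantumLattice (su2Quat norm_su2Quat)
open Literature.MathematicalPhysics.QuantumFieldTheory.Balaban1983to89
open T4CubeChartGnomonic (SU2)
open T4HaarSU2ExpChart (imQuat norm_imQuat exp_imQuat imQuat_re expPoint expPoint_zero su2Quat_expPoint)
open T4HaarSU2Translate (su2Quat_mul su2Quat_one)
open T4ExpWindowSmallField (logVec norm_logVec expPoint_logVec dist1_eq_norm_su2Quat_sub_one)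
open Summit.QuantumFields.YangMills.Theorems.FluctuationComparisonRegPrIntLS2BetaSU2FourFactorExpansion
  (norm_exp_imQuat_sub_one_sub_le norm_exp_imQuat_sub_one_le norm_mul_sub_one_sub_add_le norm_lincurl_le_dist1_add)
open Summit.QuantumFields.YangMills.Theorems.FluctuationComparisonRegPrIntLS2BetaDistributedHolonomySU2 (expPoint_add_smul)

/-! ## §1 The exponential of a pure-imaginary quaternion to third order -/

/-- `(ι x)² = −‖x‖²` (a pure-imaginary quaternion squares to minus its norm squared). [folklore] -/
theorem imQuat_mul_self (x : EuclideanSpace ℝ (Fin 3)) : imQuat x * imQuat x = -((‖x‖ ^ 2 : ℝ) : ℍ) := by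
  have h := Quaternion.sq_eq_neg_normSq.mpr (imQuat_re x)
  rw [sq] at h
  rw [h, Quaternion.normSq_eq_norm_mul_self, norm_imQuat, sq]

/-- `‖(ι x)²‖ = ‖x‖²`. [folklore] -/
theorem norm_imQuat_mul_self (x : EuclideanSpace ℝ (Fin 3)) : ‖imQuat x * imQuat x‖ = ‖x‖ ^ 2 := by
  rw [norm_mul, norm_imQuat, sq]

/-- ★ **`exp (ι x)` TO THIRD ORDER** (doubled, no halves): `‖2·(exp (ι x) − 1 − ι x) − (ι x)²‖ ≤ ‖x‖³∕2` for `‖x‖ ≤ 1`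
(`exp (ι x) = cos ‖x‖ + sinc ‖x‖ · ι x`, `|2(cos t − 1) + t²| ≤ (5∕48)t⁴`, `2|sinc t − 1|·t = 2(t − sin t) ≤ t³∕3`). [folklore] -/
theorem norm_two_mul_exp_imQuat_sub_le {x : EuclideanSpace ℝ (Fin 3)} (hx : ‖x‖ ≤ 1) :
    ‖2 * (exp (imQuat x) - 1 - imQuat x) - imQuat x * imQuat x‖ ≤ ‖x‖ ^ 3 / 2 := by
  set t := ‖x‖ with ht
  have ht0 : 0 ≤ t := norm_nonneg _
  rw [exp_imQuat, imQuat_mul_self, ← ht]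
  have hsplit : 2 * (((Real.cos t : ℝ) : ℍ) + Real.sinc t • imQuat x - 1 - imQuat x) - -(((t ^ 2 : ℝ)) : ℍ)
      = (((2 * (Real.cos t - 1) + t ^ 2 : ℝ)) : ℍ) + (2 * (Real.sinc t - 1)) • imQuat x := by
    rw [two_mul]
    ext <;> simp [T4HaarSU2ExpChart.imQuat_apply] <;> ring
  rw [hsplit]
  have hcos : ‖(((2 * (Real.cos t - 1) + t ^ 2 : ℝ)) : ℍ)‖ ≤ 5 / 48 * t ^ 4 := by
    rw [Quaternion.norm_coe, Real.norm_eq_abs, show 2 * (Real.cos t - 1) + t ^ 2 = 2 * (Real.cos t - (1 - t ^ 2 / 2)) by ring,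
      abs_mul, abs_two]
    have h := Real.cos_bound (x := t) (by rwa [abs_of_nonneg ht0])
    rw [abs_of_nonneg ht0] at h
    linarith
  have hsin : ‖(2 * (Real.sinc t - 1)) • imQuat x‖ ≤ t ^ 3 / 3 := by
    rw [norm_smul, norm_imQuat, ← ht, Real.norm_eq_abs, abs_mul, abs_two]
    rcases eq_or_lt_of_le ht0 with h0 | hpos
    · rw [← h0, mul_zero]; positivity
    · rw [Real.sinc_of_ne_zero hpos.ne', show Real.sin t / t - 1 = (Real.sin t - t) / t by field_simp, abs_div,
        abs_of_pos hpos, mul_assoc, div_mul_cancel₀ _ hpos.ne', abs_sub_comm, abs_of_nonneg (sub_nonneg.mpr (Real.sin_le ht0))]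
      have h3 := Real.sin_gt_sub_cube hpos
      linarith
  have ht3 : 0 ≤ t ^ 3 := by positivity
  have ht4 : t ^ 4 ≤ t ^ 3 := by
    rw [show t ^ 4 = t ^ 3 * t by ring]
    exact mul_le_of_le_one_right ht3 hx
  calc ‖(((2 * (Real.cos t - 1) + t ^ 2 : ℝ)) : ℍ) + (2 * (Real.sinc t - 1)) • imQuat x‖ ≤ 5 / 48 * t ^ 4 + t ^ 3 / 3 :=
        norm_add_le_of_le hcos hsin
    _ ≤ t ^ 3 / 2 := by linarith

/-! ## §2 Products of near-identity elements to second order (any normed ring) -/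

/-- ★ **TWO FACTORS TO SECOND ORDER** (doubled bookkeeping): with `‖x − 1‖ ≤ α`, `‖y − 1‖ ≤ β`, `‖x − 1 − a‖ ≤ α′`, `‖y − 1 − b‖ ≤ β′`, `‖a‖ ≤ α″`, `‖b‖ ≤ β″`,
`‖2(x − 1) − 2a − q_a‖ ≤ ρ`, `‖2(y − 1) − 2b − q_b‖ ≤ ρ′`: the product `xy` has the same data with `a + b`, `q_a + q_b + 2ab` and the bounds
`α + β + αβ`, `α′ + β′ + αβ`, `α″ + β″`, `ρ + ρ′ + 2(α′β + α″β′)`. [folklore] -/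
theorem norm_mul_second_order {A : Type*} [NormedRing A] [NormOneClass A] {x y a b qa qb : A} {α β α' β' α'' β'' ρ ρ' : ℝ}
    (hx : ‖x - 1‖ ≤ α) (hy : ‖y - 1‖ ≤ β) (hxa : ‖x - 1 - a‖ ≤ α') (hyb : ‖y - 1 - b‖ ≤ β') (ha : ‖a‖ ≤ α'') (hb : ‖b‖ ≤ β'')
    (hqa : ‖2 * (x - 1) - 2 * a - qa‖ ≤ ρ) (hqb : ‖2 * (y - 1) - 2 * b - qb‖ ≤ ρ') :
    ‖x * y - 1‖ ≤ α + β + α * β ∧ ‖x * y - 1 - (a + b)‖ ≤ α' + β' + α * β ∧ ‖a + b‖ ≤ α'' + β'' ∧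
      ‖2 * (x * y - 1) - 2 * (a + b) - (qa + qb + 2 * (a * b))‖ ≤ ρ + ρ' + 2 * (α' * β + α'' * β') := by
  have hα' : 0 ≤ α' := (norm_nonneg _).trans hxa
  have hα'' : 0 ≤ α'' := (norm_nonneg _).trans ha
  obtain ⟨h1, h2⟩ := norm_mul_sub_one_sub_add_le hx hy hxa hyb
  refine ⟨h2, h1, norm_add_le_of_le ha hb, ?_⟩
  have e : 2 * (x * y - 1) - 2 * (a + b) - (qa + qb + 2 * (a * b))
      = (2 * (x - 1) - 2 * a - qa) + (2 * (y - 1) - 2 * b - qb) + 2 * ((x - 1 - a) * (y - 1) + a * (y - 1 - b)) := by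
    noncomm_ring
  rw [e]
  -- `‖2z‖ ≤ 2‖z‖` (= lit ✓`B8Eq151V2Divergence.norm_two_mul_le`, not imported to keep this file light)
  have h2z : ∀ z : A, ‖2 * z‖ ≤ 2 * ‖z‖ := fun z => by rw [two_mul, two_mul]; exact norm_add_le _ _
  refine norm_add_le_of_le (norm_add_le_of_le hqa hqb) ((h2z _).trans ?_)
  have h3 : ‖(x - 1 - a) * (y - 1) + a * (y - 1 - b)‖ ≤ α' * β + α'' * β' :=
    norm_add_le_of_le ((norm_mul_le _ _).trans (mul_le_mul hxa hy (norm_nonneg _) hα'))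
      ((norm_mul_le _ _).trans (mul_le_mul ha hyb (norm_nonneg _) hα''))
  linarith

/-! ## §3 The plaquette word of four exponentials to third order -/

/-- ★ **FOUR NEAR-IDENTITY FACTORS TO SECOND ORDER** (any normed ring; the bookkeeping of three applications of §2): per-factor data
`‖x_i − 1‖ ≤ τ`, `‖x_i − 1 − a_i‖ ≤ τ²`, `‖a_i‖ ≤ τ`, `‖2(x_i − 1) − 2a_i − a_i²‖ ≤ τ³∕2` with `0 ≤ τ ≤ 1∕4` give
`‖2(x₁x₂x₃x₄ − 1) − 2Σa_i − (Σ a_i² + 2Σ_{i<j} a_i a_j)‖ ≤ 35τ³` (the quadratic polynomial in the nested form §2 produces; `34.5 ≤ 35`). [folklore] -/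
theorem norm_fourFactor_second_order {A : Type*} [NormedRing A] [NormOneClass A] {x₁ x₂ x₃ x₄ a₁ a₂ a₃ a₄ : A} {τ : ℝ}
    (hτ0 : 0 ≤ τ) (hτ : τ ≤ 1 / 4)
    (hx₁ : ‖x₁ - 1‖ ≤ τ) (hx₁' : ‖x₁ - 1 - a₁‖ ≤ τ ^ 2) (ha₁ : ‖a₁‖ ≤ τ) (hq₁ : ‖2 * (x₁ - 1) - 2 * a₁ - a₁ * a₁‖ ≤ τ ^ 3 / 2)
    (hx₂ : ‖x₂ - 1‖ ≤ τ) (hx₂' : ‖x₂ - 1 - a₂‖ ≤ τ ^ 2) (ha₂ : ‖a₂‖ ≤ τ) (hq₂ : ‖2 * (x₂ - 1) - 2 * a₂ - a₂ * a₂‖ ≤ τ ^ 3 / 2)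
    (hx₃ : ‖x₃ - 1‖ ≤ τ) (hx₃' : ‖x₃ - 1 - a₃‖ ≤ τ ^ 2) (ha₃ : ‖a₃‖ ≤ τ) (hq₃ : ‖2 * (x₃ - 1) - 2 * a₃ - a₃ * a₃‖ ≤ τ ^ 3 / 2)
    (hx₄ : ‖x₄ - 1‖ ≤ τ) (hx₄' : ‖x₄ - 1 - a₄‖ ≤ τ ^ 2) (ha₄ : ‖a₄‖ ≤ τ) (hq₄ : ‖2 * (x₄ - 1) - 2 * a₄ - a₄ * a₄‖ ≤ τ ^ 3 / 2) :
    ‖2 * (x₁ * x₂ * x₃ * x₄ - 1) - 2 * (a₁ + a₂ + a₃ + a₄)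
        - (a₁ * a₁ + a₂ * a₂ + 2 * (a₁ * a₂) + a₃ * a₃ + 2 * ((a₁ + a₂) * a₃) + a₄ * a₄ + 2 * ((a₁ + a₂ + a₃) * a₄))‖
      ≤ 35 * τ ^ 3 := by
  -- two factors
  obtain ⟨h12, h12', h12'', h12q⟩ := norm_mul_second_order hx₁ hx₂ hx₁' hx₂' ha₁ ha₂ hq₁ hq₂
  have g12 : ‖x₁ * x₂ - 1‖ ≤ 9 / 4 * τ := h12.trans (by nlinarith only [hτ0, hτ])
  have g12' : ‖x₁ * x₂ - 1 - (a₁ + a₂)‖ ≤ 3 * τ ^ 2 := h12'.trans (by nlinarith only [hτ0, hτ])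
  have g12'' : ‖a₁ + a₂‖ ≤ 2 * τ := h12''.trans (by linarith only [hτ0])
  have g12q : ‖2 * (x₁ * x₂ - 1) - 2 * (a₁ + a₂) - (a₁ * a₁ + a₂ * a₂ + 2 * (a₁ * a₂))‖ ≤ 5 * τ ^ 3 := h12q.trans (by nlinarith only [hτ0, hτ])
  -- three factors
  obtain ⟨h123, h123', h123'', h123q⟩ := norm_mul_second_order g12 hx₃ g12' hx₃' g12'' ha₃ g12q hq₃
  have g123 : ‖x₁ * x₂ * x₃ - 1‖ ≤ 4 * τ := h123.trans (by nlinarith only [hτ0, hτ])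
  have g123' : ‖x₁ * x₂ * x₃ - 1 - (a₁ + a₂ + a₃)‖ ≤ 25 / 4 * τ ^ 2 := h123'.trans (by nlinarith only [hτ0, hτ])
  have g123'' : ‖a₁ + a₂ + a₃‖ ≤ 3 * τ := h123''.trans (by linarith only [hτ0])
  have g123q : ‖2 * (x₁ * x₂ * x₃ - 1) - 2 * (a₁ + a₂ + a₃)
      - (a₁ * a₁ + a₂ * a₂ + 2 * (a₁ * a₂) + a₃ * a₃ + 2 * ((a₁ + a₂) * a₃))‖ ≤ 31 / 2 * τ ^ 3 := h123q.trans (by nlinarith only [hτ0, hτ])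
  -- four factors
  obtain ⟨-, -, -, h1234q⟩ := norm_mul_second_order g123 hx₄ g123' hx₄' g123'' ha₄ g123q hq₄
  exact h1234q.trans (by nlinarith only [hτ0, hτ])

/-- ★★ **THE PLAQUETTE WORD TO THIRD ORDER**: for `‖a‖, ‖b‖, ‖c‖, ‖d‖ ≤ τ ≤ 1∕4` and `q := su2Quat (e^a · e^b · (e^c)⁻¹ · (e^d)⁻¹)`, `ℓ := a + b − c − d`,
    `‖2·(q − 1 − ιℓ) − (ιℓ)² − K‖ ≤ 35 τ³`,   `K = [ιa,ιb] − [ιa,ιc] − [ιa,ιd] − [ιb,ιc] − [ιb,ιd] + [ιc,ιd]`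
(`[p,q] = pq − qp`; i.e. `q = 1 + ιℓ + ½(ιℓ)² + ½K + R₃`, `‖R₃‖ ≤ 17.5τ³`): `norm_fourFactor_second_order` for the factors `e^{ιa}, e^{ιb}, e^{−ιc}, e^{−ιd}` with the
per-factor data of §1, and `Σ_i a_i² + 2Σ_{i<j} a_i a_j = (Σ_i a_i)² + Σ_{i<j} [a_i, a_j]`. [cite: Balaban1985Variational, (34) p.283] -/
theorem norm_su2Quat_plaq4_second_le {a b c d : EuclideanSpace ℝ (Fin 3)} {τ : ℝ} (ha : ‖a‖ ≤ τ) (hb : ‖b‖ ≤ τ)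
    (hc : ‖c‖ ≤ τ) (hd : ‖d‖ ≤ τ) (hτ : τ ≤ 1 / 4) :
    ‖2 * (su2Quat (expPoint a * expPoint b * (expPoint c)⁻¹ * (expPoint d)⁻¹) - 1 - imQuat (a + b - c - d))
        - imQuat (a + b - c - d) * imQuat (a + b - c - d)
        - ((imQuat a * imQuat b - imQuat b * imQuat a) - (imQuat a * imQuat c - imQuat c * imQuat a)
            - (imQuat a * imQuat d - imQuat d * imQuat a) - (imQuat b * imQuat c - imQuat c * imQuat b)
            - (imQuat b * imQuat d - imQuat d * imQuat b) + (imQuat c * imQuat d - imQuat d * imQuat c))‖ ≤ 35 * τ ^ 3 := by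
  have hτ0 : 0 ≤ τ := (norm_nonneg _).trans ha
  have hτ1 : τ ≤ 1 := by linarith
  -- `expPoint (−x) = (expPoint x)⁻¹` (the ray is a one-parameter group)
  have expPoint_neg : ∀ x : EuclideanSpace ℝ (Fin 3), expPoint (-x) = (expPoint x)⁻¹ := fun x => by
    have h := expPoint_add_smul x 1 (-1)
    rw [add_neg_cancel, zero_smul, expPoint_zero, one_smul, neg_one_smul] at h
    exact (eq_inv_of_mul_eq_one_right h.symm)
  rw [← expPoint_neg c, ← expPoint_neg d, su2Quat_mul, su2Quat_mul, su2Quat_mul, su2Quat_expPoint, su2Quat_expPoint,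
    su2Quat_expPoint, su2Quat_expPoint]
  -- per-factor data: chord ≤ τ, second-order remainder ≤ τ², first-order term ≤ τ, third-order remainder ≤ τ³∕2
  have h1 : ∀ {x : EuclideanSpace ℝ (Fin 3)}, ‖x‖ ≤ τ →
      ‖exp (imQuat x) - 1‖ ≤ τ ∧ ‖exp (imQuat x) - 1 - imQuat x‖ ≤ τ ^ 2 ∧ ‖imQuat x‖ ≤ τ ∧
        ‖2 * (exp (imQuat x) - 1) - 2 * imQuat x - imQuat x * imQuat x‖ ≤ τ ^ 3 / 2 := fun {x} hx =>
    ⟨(norm_exp_imQuat_sub_one_le x).trans hx,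
      (norm_exp_imQuat_sub_one_sub_le (hx.trans hτ1)).trans (pow_le_pow_left₀ (norm_nonneg _) hx 2),
      (norm_imQuat x).le.trans hx, by
        rw [show 2 * (exp (imQuat x) - 1) - 2 * imQuat x = 2 * (exp (imQuat x) - 1 - imQuat x) by noncomm_ring]
        exact (norm_two_mul_exp_imQuat_sub_le (hx.trans hτ1)).trans
          (div_le_div_of_nonneg_right (pow_le_pow_left₀ (norm_nonneg _) hx 3) (by norm_num))⟩
  have hc' : ‖-c‖ ≤ τ := by rwa [norm_neg]
  have hd' : ‖-d‖ ≤ τ := by rwa [norm_neg]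
  obtain ⟨ha1, ha2, ha3, ha4⟩ := h1 ha
  obtain ⟨hb1, hb2, hb3, hb4⟩ := h1 hb
  obtain ⟨hc1, hc2, hc3, hc4⟩ := h1 hc'
  obtain ⟨hd1, hd2, hd3, hd4⟩ := h1 hd'
  have H := norm_fourFactor_second_order hτ0 hτ ha1 ha2 ha3 ha4 hb1 hb2 hb3 hb4 hc1 hc2 hc3 hc4 hd1 hd2 hd3 hd4
  rw [map_neg, map_neg] at H
  rw [map_neg, map_neg, map_sub, map_sub, map_add]
  refine le_trans (le_of_eq ?_) H
  congr 1
  noncomm_ring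

/-! ## §4 Commutators: the variation form of `K` and the user-facing letters -/

/-- **COMMUTATOR LIPSCHITZ** (both arguments move; sizes free): `‖[p,q] − [p′,q′]‖ ≤ 2‖p − p′‖‖q‖ + 2‖p′‖‖q − q′‖`
(`‖[p,q]‖ ≤ 2‖p‖‖q‖` = ✓`UnitScaleTiltProp7WordCommutatorSplit.norm_comm_le`, re-derived inline to keep this file light). [folklore] -/
theorem norm_comm_sub_comm_le_add {A : Type*} [NormedRing A] (p q p' q' : A) :
    ‖(p * q - q * p) - (p' * q' - q' * p')‖ ≤ 2 * ‖p - p'‖ * ‖q‖ + 2 * ‖p'‖ * ‖q - q'‖ := by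
  have comm_le : ∀ u v : A, ‖u * v - v * u‖ ≤ 2 * ‖u‖ * ‖v‖ := fun u v => by
    have h1 := norm_mul_le u v
    have h2 := norm_mul_le v u
    have h3 := norm_sub_le (u * v) (v * u)
    nlinarith only [h1, h2, h3]
  have e : (p * q - q * p) - (p' * q' - q' * p') = ((p - p') * q - q * (p - p')) + (p' * (q - q') - (q - q') * p') := by
    noncomm_ring
  rw [e]
  exact norm_add_le_of_le (comm_le _ _) (comm_le _ _)

/-- ★ **THE VARIATION FORM OF THE COMMUTATOR SUM**: with `γ := C − A`, `δ := B − D` (the two parallel variations of a plaquette word `A, B, −C, −D`),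
`K := [A,B] − [A,C] − [A,D] − [B,C] − [B,D] + [C,D] = 2[A,D] + 2[A,δ] − [A,γ] − 2[D,γ] + [D,δ] − [δ,γ]`, hence for `‖A‖, ‖D‖ ≤ τ`:
`‖K − 2[A,D]‖ ≤ 6τ(‖C − A‖ + ‖B − D‖) + 2‖C − A‖‖B − D‖` (any normed ring). [folklore] -/
theorem norm_commSum_sub_two_comm_le {R : Type*} [NormedRing R] (A B C D : R) {τ : ℝ} (hA : ‖A‖ ≤ τ) (hD : ‖D‖ ≤ τ) :
    ‖((A * B - B * A) - (A * C - C * A) - (A * D - D * A) - (B * C - C * B) - (B * D - D * B) + (C * D - D * C))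
        - 2 * (A * D - D * A)‖ ≤ 6 * τ * (‖C - A‖ + ‖B - D‖) + 2 * ‖C - A‖ * ‖B - D‖ := by
  have hτ : 0 ≤ τ := (norm_nonneg _).trans hA
  have e : ((A * B - B * A) - (A * C - C * A) - (A * D - D * A) - (B * C - C * B) - (B * D - D * B) + (C * D - D * C))
        - 2 * (A * D - D * A)
      = 2 * (A * (B - D) - (B - D) * A) - (A * (C - A) - (C - A) * A) - 2 * (D * (C - A) - (C - A) * D)
        + (D * (B - D) - (B - D) * D) - ((B - D) * (C - A) - (C - A) * (B - D)) := by
    noncomm_ring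
  rw [e]
  have comm_le : ∀ u v : R, ‖u * v - v * u‖ ≤ 2 * ‖u‖ * ‖v‖ := fun u v => by
    have h1 := norm_mul_le u v
    have h2 := norm_mul_le v u
    have h3 := norm_sub_le (u * v) (v * u)
    nlinarith only [h1, h2, h3]
  have h2z : ∀ z : R, ‖2 * z‖ ≤ 2 * ‖z‖ := fun z => by rw [two_mul, two_mul]; exact norm_add_le _ _
  have h1 := comm_le A (B - D)
  have h2 := comm_le A (C - A)
  have h3 := comm_le D (C - A)
  have h4 := comm_le D (B - D)
  have h5 := comm_le (B - D) (C - A)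
  have h1' := (h2z (A * (B - D) - (B - D) * A)).trans (mul_le_mul_of_nonneg_left h1 zero_le_two)
  have h3' := (h2z (D * (C - A) - (C - A) * D)).trans (mul_le_mul_of_nonneg_left h3 zero_le_two)
  have hγ : 0 ≤ ‖C - A‖ := norm_nonneg _
  have hδ : 0 ≤ ‖B - D‖ := norm_nonneg _
  calc _ ≤ 2 * (2 * ‖A‖ * ‖B - D‖) + 2 * ‖A‖ * ‖C - A‖ + 2 * (2 * ‖D‖ * ‖C - A‖) + 2 * ‖D‖ * ‖B - D‖ + 2 * ‖B - D‖ * ‖C - A‖ :=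
        norm_sub_le_of_le (norm_add_le_of_le (norm_sub_le_of_le (norm_sub_le_of_le h1' h2) h3') h4) h5
    _ ≤ 2 * (2 * τ * ‖B - D‖) + 2 * τ * ‖C - A‖ + 2 * (2 * τ * ‖C - A‖) + 2 * τ * ‖B - D‖ + 2 * ‖B - D‖ * ‖C - A‖ := by
        gcongr
    _ = 6 * τ * (‖C - A‖ + ‖B - D‖) + 2 * ‖C - A‖ * ‖B - D‖ := by ring

/-- ★★ **CHORD ≤ «LINEARISED CURL + BASE COMMUTATOR» + junk**: for `‖a‖, ‖b‖, ‖c‖, ‖d‖ ≤ τ ≤ 1∕4`,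
`dist1 (e^a e^b (e^c)⁻¹ (e^d)⁻¹) ≤ ‖ι(a+b−c−d) + [ιa, ιd]‖ + ½‖a+b−c−d‖² + 3τ(‖c−a‖ + ‖b−d‖) + ‖c−a‖‖b−d‖ + (35∕2)τ³`
— for the lattice plaquette `U(x,μ)U(x+μ,ν)U(x+ν,μ)⁻¹U(x,ν)⁻¹` the junk is SIZE × PARALLEL VARIATION + VARIATION² + SIZE³, no SIZE². [cite: Balaban1985Variational, (34) p.283] -/
theorem dist1_plaq4_le_comm {a b c d : EuclideanSpace ℝ (Fin 3)} {τ : ℝ} (ha : ‖a‖ ≤ τ) (hb : ‖b‖ ≤ τ)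
    (hc : ‖c‖ ≤ τ) (hd : ‖d‖ ≤ τ) (hτ : τ ≤ 1 / 4) :
    dist1 (expPoint a * expPoint b * (expPoint c)⁻¹ * (expPoint d)⁻¹)
      ≤ ‖imQuat (a + b - c - d) + (imQuat a * imQuat d - imQuat d * imQuat a)‖ + ‖a + b - c - d‖ ^ 2 / 2
        + 3 * τ * (‖c - a‖ + ‖b - d‖) + ‖c - a‖ * ‖b - d‖ + 35 / 2 * τ ^ 3 := by
  have hm := norm_su2Quat_plaq4_second_le ha hb hc hd hτ
  have hK := norm_commSum_sub_two_comm_le (imQuat a) (imQuat b) (imQuat c) (imQuat d) (τ := τ)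
    (by rwa [norm_imQuat]) (by rwa [norm_imQuat])
  rw [← map_sub, ← map_sub, norm_imQuat, norm_imQuat] at hK
  set Pq := su2Quat (expPoint a * expPoint b * (expPoint c)⁻¹ * (expPoint d)⁻¹) with hPq
  set L := imQuat (a + b - c - d) with hL
  set Q := imQuat a * imQuat d - imQuat d * imQuat a with hQ
  set K := (imQuat a * imQuat b - imQuat b * imQuat a) - (imQuat a * imQuat c - imQuat c * imQuat a)
      - (imQuat a * imQuat d - imQuat d * imQuat a) - (imQuat b * imQuat c - imQuat c * imQuat b)
      - (imQuat b * imQuat d - imQuat d * imQuat b) + (imQuat c * imQuat d - imQuat d * imQuat c) with hKdef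
  have hLL : ‖L * L‖ = ‖a + b - c - d‖ ^ 2 := norm_imQuat_mul_self _
  have e : 2 * (Pq - 1) = (2 * (Pq - 1 - L) - L * L - K) + L * L + (K - 2 * Q) + 2 * (L + Q) := by noncomm_ring
  have h2 : ‖2 * (Pq - 1)‖ = 2 * ‖Pq - 1‖ := by
    rw [norm_mul, show (2 : ℍ) = ((2 : ℝ) : ℍ) by norm_cast, Quaternion.norm_coe, Real.norm_eq_abs, abs_two]
  have h3 : ‖2 * (L + Q)‖ = 2 * ‖L + Q‖ := by
    rw [norm_mul, show (2 : ℍ) = ((2 : ℝ) : ℍ) by norm_cast, Quaternion.norm_coe, Real.norm_eq_abs, abs_two]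
  have h4 : ‖2 * (Pq - 1)‖ ≤ 35 * τ ^ 3 + ‖a + b - c - d‖ ^ 2 + (6 * τ * (‖c - a‖ + ‖b - d‖) + 2 * ‖c - a‖ * ‖b - d‖) + 2 * ‖L + Q‖ := by
    rw [e]
    exact norm_add_le_of_le (norm_add_le_of_le (norm_add_le_of_le hm hLL.le) hK) h3.le
  rw [dist1_eq_norm_su2Quat_sub_one, ← hPq]
  linarith

/-- ★★ **THE CONVERSE: «LINEARISED CURL + BASE COMMUTATOR» ≤ CHORD + junk**:
`‖ι(a+b−c−d) + [ιa, ιd]‖ ≤ dist1 (e^a e^b (e^c)⁻¹ (e^d)⁻¹) + ½‖a+b−c−d‖² + 3τ(‖c−a‖ + ‖b−d‖) + ‖c−a‖‖b−d‖ + (35∕2)τ³`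
— a SMALL plaquette forces its linearised curl to cancel the commutator of its two directions, up to cubic and variation terms. [cite: Balaban1985Variational, (34) p.283] -/
theorem norm_lincurl_add_comm_le_dist1_add {a b c d : EuclideanSpace ℝ (Fin 3)} {τ : ℝ} (ha : ‖a‖ ≤ τ) (hb : ‖b‖ ≤ τ)
    (hc : ‖c‖ ≤ τ) (hd : ‖d‖ ≤ τ) (hτ : τ ≤ 1 / 4) :
    ‖imQuat (a + b - c - d) + (imQuat a * imQuat d - imQuat d * imQuat a)‖
      ≤ dist1 (expPoint a * expPoint b * (expPoint c)⁻¹ * (expPoint d)⁻¹) + ‖a + b - c - d‖ ^ 2 / 2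
        + 3 * τ * (‖c - a‖ + ‖b - d‖) + ‖c - a‖ * ‖b - d‖ + 35 / 2 * τ ^ 3 := by
  have hm := norm_su2Quat_plaq4_second_le ha hb hc hd hτ
  have hK := norm_commSum_sub_two_comm_le (imQuat a) (imQuat b) (imQuat c) (imQuat d) (τ := τ)
    (by rwa [norm_imQuat]) (by rwa [norm_imQuat])
  rw [← map_sub, ← map_sub, norm_imQuat, norm_imQuat] at hK
  set Pq := su2Quat (expPoint a * expPoint b * (expPoint c)⁻¹ * (expPoint d)⁻¹) with hPq
  set L := imQuat (a + b - c - d) with hL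
  set Q := imQuat a * imQuat d - imQuat d * imQuat a with hQ
  set K := (imQuat a * imQuat b - imQuat b * imQuat a) - (imQuat a * imQuat c - imQuat c * imQuat a)
      - (imQuat a * imQuat d - imQuat d * imQuat a) - (imQuat b * imQuat c - imQuat c * imQuat b)
      - (imQuat b * imQuat d - imQuat d * imQuat b) + (imQuat c * imQuat d - imQuat d * imQuat c) with hKdef
  have hLL : ‖L * L‖ = ‖a + b - c - d‖ ^ 2 := norm_imQuat_mul_self _
  have e : 2 * (L + Q) = 2 * (Pq - 1) - (2 * (Pq - 1 - L) - L * L - K) - L * L - (K - 2 * Q) := by noncomm_ring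
  have h2 : ‖2 * (Pq - 1)‖ = 2 * ‖Pq - 1‖ := by
    rw [norm_mul, show (2 : ℍ) = ((2 : ℝ) : ℍ) by norm_cast, Quaternion.norm_coe, Real.norm_eq_abs, abs_two]
  have h3 : ‖2 * (L + Q)‖ = 2 * ‖L + Q‖ := by
    rw [norm_mul, show (2 : ℍ) = ((2 : ℝ) : ℍ) by norm_cast, Quaternion.norm_coe, Real.norm_eq_abs, abs_two]
  have h4 : ‖2 * (L + Q)‖ ≤ 2 * ‖Pq - 1‖ + 35 * τ ^ 3 + ‖a + b - c - d‖ ^ 2 + (6 * τ * (‖c - a‖ + ‖b - d‖) + 2 * ‖c - a‖ * ‖b - d‖) := by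
    rw [e]
    exact norm_sub_le_of_le (norm_sub_le_of_le (norm_sub_le_of_le h2.le hm) hLL.le) hK
  rw [dist1_eq_norm_su2Quat_sub_one, ← hPq]
  linarith

/-- ★★ **THE SAME FOR FOUR GROUP ELEMENTS** `X₁, …, X₄ ∈ SU(2)` with arcs `≤ τ ≤ 1∕4` (`X_i = e^{log X_i}`): the linearised curl of the logarithms plus the base
commutator `[ι log X₁, ι log X₄]` is within `½‖ℓ‖² + 3τ(‖log X₃ − log X₁‖ + ‖log X₂ − log X₄‖) + ‖log X₃ − log X₁‖·‖log X₂ − log X₄‖ + (35∕2)τ³` of the CHORD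
`dist1 (X₁X₂X₃⁻¹X₄⁻¹)`. [cite: Balaban1985Variational, (34) p.283] -/
theorem norm_lincurl_logVec_add_comm_le (X₁ X₂ X₃ X₄ : SU2) {τ : ℝ} (h₁ : ‖logVec (su2Quat X₁)‖ ≤ τ) (h₂ : ‖logVec (su2Quat X₂)‖ ≤ τ)
    (h₃ : ‖logVec (su2Quat X₃)‖ ≤ τ) (h₄ : ‖logVec (su2Quat X₄)‖ ≤ τ) (hτ : τ ≤ 1 / 4) :
    ‖imQuat (logVec (su2Quat X₁) + logVec (su2Quat X₂) - logVec (su2Quat X₃) - logVec (su2Quat X₄))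
        + (imQuat (logVec (su2Quat X₁)) * imQuat (logVec (su2Quat X₄)) - imQuat (logVec (su2Quat X₄)) * imQuat (logVec (su2Quat X₁)))‖
      ≤ dist1 (X₁ * X₂ * X₃⁻¹ * X₄⁻¹)
        + ‖logVec (su2Quat X₁) + logVec (su2Quat X₂) - logVec (su2Quat X₃) - logVec (su2Quat X₄)‖ ^ 2 / 2
        + 3 * τ * (‖logVec (su2Quat X₃) - logVec (su2Quat X₁)‖ + ‖logVec (su2Quat X₂) - logVec (su2Quat X₄)‖)
        + ‖logVec (su2Quat X₃) - logVec (su2Quat X₁)‖ * ‖logVec (su2Quat X₂) - logVec (su2Quat X₄)‖ + 35 / 2 * τ ^ 3 := by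
  have h := norm_lincurl_add_comm_le_dist1_add h₁ h₂ h₃ h₄ hτ
  rwa [expPoint_logVec, expPoint_logVec, expPoint_logVec, expPoint_logVec] at h

/-- **THE LINEARISED CURL SQUARED IS FOURTH ORDER IN PRACTICE**: `½‖ℓ‖² ≤ ½(dist1 + 12τ²)²` by the first-order letter ✓`norm_lincurl_le_dist1_add`. [folklore] -/
theorem sq_norm_lincurl_div_two_le {a b c d : EuclideanSpace ℝ (Fin 3)} {τ : ℝ} (ha : ‖a‖ ≤ τ) (hb : ‖b‖ ≤ τ)
    (hc : ‖c‖ ≤ τ) (hd : ‖d‖ ≤ τ) (hτ : τ ≤ 1 / 4) :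
    ‖a + b - c - d‖ ^ 2 / 2 ≤ (dist1 (expPoint a * expPoint b * (expPoint c)⁻¹ * (expPoint d)⁻¹) + 12 * τ ^ 2) ^ 2 / 2 := by
  have h := norm_lincurl_le_dist1_add ha hb hc hd hτ
  have h0 : 0 ≤ ‖a + b - c - d‖ := norm_nonneg _
  exact div_le_div_of_nonneg_right (pow_le_pow_left₀ h0 h 2) (by norm_num)

end Summit.QuantumFields.YangMills.Theorems.FluctuationComparisonRegPrIntLS2BetaSU2FourFactorSecondOrder
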